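import Mathlib
import Literature.Geometry.Symplectic.JHolomorphicSheetChart
import HarnessLib

/-!
# The sheet chart is a local diffeomorphism (inverse function theorem package)

Continuation of `Literature/Geometry/Symplectic/JHolomorphicSheetChart.lean`. For a smooth operator
field `J` on a `4`-dimensional real normed space `F` and a smooth map `b : ℂ → F` that is immersed
and `J`-holomorphic at `z₁` with `J (b z₁)² = -1`, the sheet chart
`E = sheetChart J b ν₀ : (z, w) ↦ b z + (Re w) • ν₀ + (Im w) • J (b z) ν₀` (for a suitable normal
vector `ν₀`) is a local diffeomorphism at `(z₁, 0)`: we package it as an `OpenPartialHomeomorph`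
`e` with `⇑e = E`, `(z₁, 0) ∈ e.source`, smooth inverse on `e.target`, and a uniform lower bound
`‖q‖ ≤ B ‖dE_p q‖` on a ball `B((z₁,0), r) ⊆ e.source` (hypothesis `hB` of
`Literature.Geometry.Symplectic.sheetDbarInequality`). This is Mathlib's inverse function theorem
(`HasStrictFDerivAt.toOpenPartialHomeomorph`, `OpenPartialHomeomorph.contDiffAt_symm`) applied to
`exists_bijective_sheetChartDeriv`; it is the coordinate change of McDuff (1991), Lemma 2.5 /
McDuff–Salamon (2012), §2.4, in which intersections with the sheet `b` become zeros of the normal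
coordinate `w`.

* `exists_sheetChart_localInverse` — the package above.

## References

* D. McDuff, *The local behaviour of holomorphic curves in almost complex 4-manifolds*,
  J. Differential Geom. 34 (1991), Lemma 2.5. [McDuff1991LocalBehaviour]
* D. McDuff, D. Salamon, *J-holomorphic curves and symplectic topology*, 2nd ed. (2012), §2.4.
  [McDuffSalamon2012]
-/

noncomputable section

open scoped ContDiff Topology
open Set Function Metric

namespace Literature.Geometry.Symplectic

variable {F : Type*} [NormedAddCommGroup F] [NormedSpace ℝ F] [FiniteDimensional ℝ F]

/-- **A uniform lower bound for a continuous family of operators near an invertible one.** If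
`A : X → (E →L F)` is continuous at `x₀` and `A x₀ = L` is a continuous linear equivalence, then
`‖q‖ ≤ 2 ‖L⁻¹‖ ‖A x q‖` for `x` near `x₀`. [folklore] -/
theorem eventually_norm_le_mul_norm_apply {X E G : Type*} [TopologicalSpace X]
    [NormedAddCommGroup E] [NormedSpace ℝ E] [NormedAddCommGroup G] [NormedSpace ℝ G]
    {A : X → E →L[ℝ] G} {x₀ : X} (hA : ContinuousAt A x₀) (L : E ≃L[ℝ] G)
    (hL : A x₀ = (L : E →L[ℝ] G)) :
    ∀ᶠ x in 𝓝 x₀, ∀ q : E, ‖q‖ ≤ 2 * ‖(L.symm : G →L[ℝ] E)‖ * ‖A x q‖ := by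
  set N : ℝ := ‖(L.symm : G →L[ℝ] E)‖ with hN
  have hN0 : 0 ≤ N := norm_nonneg _
  have hδ : 0 < 1 / (2 * (N + 1)) := by positivity
  have hev : ∀ᶠ x in 𝓝 x₀, dist (A x) (A x₀) < 1 / (2 * (N + 1)) :=
    (Metric.tendsto_nhds.1 hA) _ hδ
  filter_upwards [hev] with x hx q
  rw [dist_eq_norm, hL] at hx
  -- `q = L⁻¹ (L q)` and `L q = A x q + (L - A x) q`
  have h1 : ‖q‖ ≤ N * ‖(L : E →L[ℝ] G) q‖ := by
    calc ‖q‖ = ‖(L.symm : G →L[ℝ] E) ((L : E →L[ℝ] G) q)‖ := by simp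
      _ ≤ N * ‖(L : E →L[ℝ] G) q‖ := ContinuousLinearMap.le_opNorm _ _
  have h2 : ‖(L : E →L[ℝ] G) q‖ ≤ ‖A x q‖ + 1 / (2 * (N + 1)) * ‖q‖ := by
    have e1 : (L : E →L[ℝ] G) q = A x q + ((L : E →L[ℝ] G) - A x) q := by
      rw [sub_apply]; abel
    calc ‖(L : E →L[ℝ] G) q‖ ≤ ‖A x q‖ + ‖((L : E →L[ℝ] G) - A x) q‖ := by
          rw [e1]; exact norm_add_le _ _
      _ ≤ ‖A x q‖ + ‖(L : E →L[ℝ] G) - A x‖ * ‖q‖ := by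
          gcongr; exact ContinuousLinearMap.le_opNorm _ _
      _ ≤ ‖A x q‖ + 1 / (2 * (N + 1)) * ‖q‖ := by
          gcongr; rw [← norm_neg, neg_sub]; exact hx.le
  have h3 : N * (1 / (2 * (N + 1))) ≤ 1 / 2 := by
    rw [mul_one_div, div_le_div_iff₀ (by positivity) (by norm_num)]
    nlinarith
  have hq0 := norm_nonneg q
  have hAq := norm_nonneg (A x q)
  nlinarith [mul_le_mul_of_nonneg_left h2 hN0, mul_le_mul_of_nonneg_right h3 hq0]

/-- **The sheet chart as a local diffeomorphism (inverse function theorem).** Let `dim F = 4`,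
`J : F → (F →L F)` and `b : ℂ → F` smooth, `b` immersed and `J`-holomorphic at `z₁`
(`db (iα) = J (b z₁) (db α)`) with `J (b z₁)² = -1`. Then for some normal vector `ν₀` the sheet
chart `E = sheetChart J b ν₀` restricts to an `OpenPartialHomeomorph` `e` with `(z₁, 0) ∈ e.source`,
whose inverse is smooth on `e.target`, and `‖q‖ ≤ B ‖dE_p q‖` uniformly on a ball
`B((z₁,0), r) ⊆ e.source`. [cite: McDuff1991LocalBehaviour, Lemma 2.5] -/
theorem exists_sheetChart_localInverse (h4 : Module.finrank ℝ F = 4) {J : F → F →L[ℝ] F}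
    {b : ℂ → F} {z₁ : ℂ} (hJ : ContDiff ℝ ∞ J) (hb : ContDiff ℝ ∞ b)
    (hinj : Injective (fderiv ℝ b z₁))
    (hbJ : ∀ α : ℂ, fderiv ℝ b z₁ (Complex.I * α) = J (b z₁) (fderiv ℝ b z₁ α))
    (hJ2 : ∀ v : F, J (b z₁) (J (b z₁) v) = -v) :
    ∃ (ν₀ : F) (e : OpenPartialHomeomorph (ℂ × ℂ) F),
      ⇑e = sheetChart J b ν₀ ∧ ((z₁, 0) : ℂ × ℂ) ∈ e.source ∧
      ContDiffOn ℝ ∞ e.symm e.target ∧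
      ∃ r B : ℝ, 0 < r ∧ ball ((z₁, 0) : ℂ × ℂ) r ⊆ e.source ∧
        ∀ p ∈ ball ((z₁, 0) : ℂ × ℂ) r, ∀ q : ℂ × ℂ,
          ‖q‖ ≤ B * ‖fderiv ℝ (sheetChart J b ν₀) p q‖ := by
  obtain ⟨ν₀, hbij⟩ := exists_bijective_sheetChartDeriv h4 hinj hbJ hJ2
  set E := sheetChart J b ν₀ with hE_def
  have hE : ContDiff ℝ ∞ E := contDiff_sheetChart hJ hb ν₀
  -- the differential at `(z₁, 0)` as a continuous linear equivalence
  set L : (ℂ × ℂ) ≃L[ℝ] F :=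
    (LinearEquiv.ofBijective ((sheetChartDeriv J b ν₀ z₁ : ℂ × ℂ →L[ℝ] F) : ℂ × ℂ →ₗ[ℝ] F)
      hbij).toContinuousLinearEquiv with hL_def
  have hLcoe : (L : ℂ × ℂ →L[ℝ] F) = sheetChartDeriv J b ν₀ z₁ :=
    ContinuousLinearMap.ext fun _ => rfl
  have hder : HasFDerivAt E (L : ℂ × ℂ →L[ℝ] F) (z₁, 0) := by
    rw [hLcoe]
    exact hasFDerivAt_sheetChart ((hb.differentiable (by simp)) z₁)
      (((hJ.clm_apply contDiff_const).differentiable (by simp)) _)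
  have hstrict : HasStrictFDerivAt E (L : ℂ × ℂ →L[ℝ] F) (z₁, 0) :=
    hE.contDiffAt.hasStrictFDerivAt' hder (by simp)
  -- the set where `dE` is invertible is an open neighbourhood of `(z₁, 0)`
  set U : Set (ℂ × ℂ) := (fun p => fderiv ℝ E p) ⁻¹'
    range ((↑) : ((ℂ × ℂ) ≃L[ℝ] F) → (ℂ × ℂ) →L[ℝ] F) with hU_def
  have hUo : IsOpen U :=
    (ContinuousLinearEquiv.isOpen (𝕜 := ℝ) (E := ℂ × ℂ) (F := F)).preimage
      (hE.continuous_fderiv (by simp))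
  have hz₁U : ((z₁, 0) : ℂ × ℂ) ∈ U := ⟨L, hder.fderiv.symm⟩
  -- the inverse function theorem, restricted to `U`
  set e₀ := hstrict.toOpenPartialHomeomorph E with he₀
  set e := e₀.restrOpen U hUo with he
  have hcoe : ⇑e = E := rfl
  have hsrc : ((z₁, 0) : ℂ × ℂ) ∈ e.source := by
    rw [he, OpenPartialHomeomorph.restrOpen_source]
    exact ⟨hstrict.mem_toOpenPartialHomeomorph_source, hz₁U⟩
  have hsrcU : e.source ⊆ U := by
    rw [he, OpenPartialHomeomorph.restrOpen_source]
    exact inter_subset_right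
  -- smoothness of the inverse on the target
  have hsymm : ContDiffOn ℝ ∞ e.symm e.target := by
    intro y hy
    have hx : e.symm y ∈ e.source := e.map_target hy
    obtain ⟨L', hL'⟩ := hsrcU hx
    have hd : HasFDerivAt e (L' : ℂ × ℂ →L[ℝ] F) (e.symm y) := by
      rw [hcoe, hL']
      exact ((hE.differentiable (by simp)) _).hasFDerivAt
    exact (e.contDiffAt_symm hy hd (by rw [hcoe]; exact hE.contDiffAt)).contDiffWithinAt
  -- the uniform lower bound near `(z₁, 0)`
  have hlow := eventually_norm_le_mul_norm_apply
    ((hE.continuous_fderiv (by simp)).continuousAt (x := ((z₁, 0) : ℂ × ℂ))) L hder.fderiv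
  obtain ⟨r, hr, hball⟩ := Metric.eventually_nhds_iff_ball.1
    (hlow.and (eventually_mem_nhds_iff.2 (e.open_source.mem_nhds hsrc)) |>.mono
      fun x hx => hx)
  refine ⟨ν₀, e, hcoe, hsrc, hsymm, r, 2 * ‖(L.symm : F →L[ℝ] ℂ × ℂ)‖, hr,
    fun p hp => ?_, fun p hp q => (hball p hp).1 q⟩
  exact mem_of_mem_nhds (hball p hp).2

end Literature.Geometry.Symplectic

end
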